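import Mathlib.NumberTheory.NumberField.InfinitePlace.Ramification
import Mathlib.NumberTheory.NumberField.Ideal.Basic
import Mathlib.RingTheory.Ideal.Pointwise
import Mathlib.RingTheory.DedekindDomain.Ideal.Lemmas
import HarnessLib

/-!
# Archimedean rigidity of a "transport of principal divisors" on a Galois number field

Classical algebraic number theory (no named facts, no definitions; PROOF-ONLY).  Let `L/ℚ` be a finite
Galois extension, `G = Gal(L/ℚ)`, and let `𝔓` be a maximal ideal of `𝓞 L` with TRIVIAL decomposition group
(`g • 𝔓 = 𝔓 → g = 1`).  Let `X ∈ 𝓞 L` generate a power `𝔓ⁿ` (`n ≠ 0`), `U` a unit of `𝓞 L`, `s ∈ G`.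

**Rigidity lemma** (`eq_smul_of_apply_smul_mul_eq`): if two infinite places `v, w` of `L` satisfy
`w (s(X) · U) = v (X)`, then `w = s • v`.

Proof ("square and read off ideals"): write `w = mk φ_w`, `v = mk φ_v`; all complex embeddings of the Galois
field `L` are twists `φ_v ∘ t` of `φ_v` (`exists_ringHom_eq_comp`), so `w = t⁻¹ • v`; complex conjugation after
`φ_v` is `φ_v ∘ c` for some `c ∈ G` fixing `v` (`exists_conjugate_eq_comp`); then
`(v x)² = φ_v (x · c x)` as complex numbers (`ofReal_apply_sq_eq`), so the hypothesis squares to an EQUALITY IN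
`L`, `t (a · c' a) = X · c X` with `a = s(X) · U`; passing to ideals of `𝓞 L` the prime `(t s) • 𝔓` divides
`𝔓ⁿ (c • 𝔓)ⁿ`, hence equals `𝔓` or `c • 𝔓` (`smul_eq_or_of_apply_smul_mul_eq`, valid for any maximal `𝔓`);
with trivial decomposition group `t s ∈ {1, c}`, i.e. `w = t⁻¹ • v = s • v`.

Use (cell abc-iut, layer L1, GAP-LEDGER G-L1t3-1 #2 — [FrdI] Thm. 6.4 (iv) compatibility clause in the
Gassmann / non-solitary case): applied to the transport of principal divisors under an equivalence of arithmetic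
Frobenioids, this forces the archimedean component of the divisor-monoid isomorphism `Ψ^Φ` to be induced by a
field automorphism.  Nothing here is specific to, or takes a side on, the disputed corpus.
-/

noncomputable section

open NumberField NumberField.InfinitePlace NumberField.ComplexEmbedding

open scoped Pointwise

namespace Literature.NumberTheory.NumberFields

variable {L : Type*} [Field L] [NumberField L]

/-! ### Complex embeddings of a Galois number field are twists of any fixed one -/

/-- For `L/ℚ` Galois, every complex embedding `ψ` of `L` is `φ ∘ σ` for a (unique) `σ ∈ Gal(L/ℚ)`: the map
`σ ↦ φ ∘ σ` is injective and both sides have `[L:ℚ]` elements. [cite: MochizukiFrdI2008, Thm. 6.4 (iv) p.115] -/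
theorem exists_ringHom_eq_comp [IsGalois ℚ L] (φ ψ : L →+* ℂ) :
    ∃ σ : L ≃ₐ[ℚ] L, ψ = φ.comp (σ : L →+* L) := by
  classical
  let f : (L ≃ₐ[ℚ] L) → (L →+* ℂ) := fun σ => φ.comp (σ : L →+* L)
  have hinj : Function.Injective f := by
    intro σ τ h
    refine AlgEquiv.ext fun x => ?_
    have hx := RingHom.congr_fun h x
    simp only [f, RingHom.coe_comp, Function.comp_apply, RingHom.coe_coe] at hx
    exact φ.injective hx
  have hcard : Nat.card (L →+* ℂ) ≤ Nat.card (L ≃ₐ[ℚ] L) := by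
    rw [IsGalois.card_aut_eq_finrank, Nat.card_eq_fintype_card, NumberField.Embeddings.card]
  obtain ⟨σ, hσ⟩ := (hinj.bijective_of_nat_card_le hcard).2 ψ
  exact ⟨σ, hσ.symm⟩

/-- Complex conjugation after a complex embedding of a Galois number field is induced by an element
`c ∈ Gal(L/ℚ)`: `conj ∘ φ = φ ∘ c`. [cite: MochizukiFrdI2008, Thm. 6.4 (iv) p.115] -/
theorem exists_conjugate_eq_comp [IsGalois ℚ L] (φ : L →+* ℂ) :
    ∃ c : L ≃ₐ[ℚ] L, conjugate φ = φ.comp (c : L →+* L) :=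
  exists_ringHom_eq_comp φ (conjugate φ)

/-- The conjugation element `c` of an embedding `φ` (`conj ∘ φ = φ ∘ c`) fixes the place of `φ`.
[cite: MochizukiFrdI2008, Thm. 6.4 (iv) p.115] -/
theorem smul_mk_eq_of_conjugate_eq_comp {φ : L →+* ℂ} {c : L ≃ₐ[ℚ] L}
    (hc : conjugate φ = φ.comp (c : L →+* L)) : c • InfinitePlace.mk φ = InfinitePlace.mk φ := by
  -- `c` is an involution: `φ (c (c x)) = conj (conj (φ x)) = φ x`
  have hcc : ∀ x, c (c x) = x := fun x => by
    apply φ.injective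
    have h1 : φ (c (c x)) = conjugate φ (c x) := by
      rw [hc]; rfl
    rw [h1, conjugate_coe_eq]
    have h2 : φ (c x) = conjugate φ x := by rw [hc]; rfl
    rw [h2, conjugate_coe_eq, Complex.conj_conj]
  have hsymm : (c.symm : L →+* L) = (c : L →+* L) := by
    refine RingHom.ext fun x => ?_
    simp only [RingHom.coe_coe]
    rw [AlgEquiv.symm_apply_eq, hcc]
  rw [smul_mk, hsymm, ← hc, mk_conjugate_eq]

/-- `(v x)² = φ (x · c x)` in `ℂ` for `v = mk φ` and `conj ∘ φ = φ ∘ c`. [cite: MochizukiFrdI2008, Thm. 6.4 (iv) p.115] -/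
theorem ofReal_apply_sq_eq {φ : L →+* ℂ} {c : L ≃ₐ[ℚ] L} (hc : conjugate φ = φ.comp (c : L →+* L))
    (x : L) : (((InfinitePlace.mk φ x) ^ 2 : ℝ) : ℂ) = φ (x * c x) := by
  rw [InfinitePlace.apply, map_mul]
  have h2 : φ (c x) = conjugate φ x := by rw [hc]; rfl
  rw [h2, conjugate_coe_eq, Complex.mul_conj, Complex.normSq_eq_norm_sq, Complex.ofReal_pow]

/-! ### The Galois action on `𝓞 L` and on its ideals -/

/-- The action of `Gal(L/ℚ)` on `𝓞 L` is the restriction of its action on `L`. [cite: MochizukiFrdI2008, Thm. 6.4 (iv) p.115] -/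
theorem coe_smul_ringOfIntegers (σ : L ≃ₐ[ℚ] L) (X : 𝓞 L) : ((σ • X : 𝓞 L) : L) = σ (X : L) := rfl

/-- The action on ideals of `𝓞 L` commutes with `Ideal.span {·}`: `σ • (X) = (σ • X)`. [cite: MochizukiFrdI2008, Thm. 6.4 (iv) p.115] -/
theorem smul_span_singleton (σ : L ≃ₐ[ℚ] L) (X : 𝓞 L) :
    σ • (Ideal.span {X} : Ideal (𝓞 L)) = Ideal.span {σ • X} := by
  rw [Ideal.pointwise_smul_def, Ideal.map_span, Set.image_singleton]
  rfl

/-- A maximal ideal dividing another maximal ideal equals it. [cite: MochizukiFrdI2008, Thm. 6.4 (iv) p.115] -/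
theorem eq_of_dvd_of_isMaximal {R : Type*} [CommRing R] {P Q : Ideal R} (hP : P.IsMaximal) (hQ : Q.IsMaximal)
    (h : P ∣ Q) : P = Q :=
  (hQ.eq_of_le hP.ne_top (Ideal.le_of_dvd h)).symm

/-! ### The rigidity lemma -/

/-- **Square-and-compare-ideals** (general maximal `𝔓`): if `w (s(X) · U) = v (X)` for infinite places `v, w` of
the Galois number field `L`, where `(X) = 𝔓ⁿ` (`n ≠ 0`) and `U` is a unit, then for the twist `t` with
`w = t⁻¹ • v` and the conjugation `c` of `v`, the prime `(t s) • 𝔓` is `𝔓` or `c • 𝔓`. [cite: MochizukiFrdI2008, Thm. 6.4 (iv) p.115] -/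
theorem smul_eq_or_of_apply_smul_mul_eq [IsGalois ℚ L] {𝔓 : Ideal (𝓞 L)} (h𝔓 : 𝔓.IsMaximal)
    {X : 𝓞 L} {n : ℕ} (hn : n ≠ 0) (hX : Ideal.span {X} = 𝔓 ^ n) (U : (𝓞 L)ˣ) (s : L ≃ₐ[ℚ] L)
    (v w : InfinitePlace L) (h : w ((s • X : 𝓞 L) * U : 𝓞 L) = v (X : L)) :
    ∃ t c : L ≃ₐ[ℚ] L, w = t⁻¹ • v ∧ c • v = v ∧ ((t * s) • 𝔓 = 𝔓 ∨ (t * s) • 𝔓 = c • 𝔓) := by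
  classical
  -- embeddings: `v = mk φ`, `w = mk (φ ∘ t)`, conjugations `c` (of `φ`) and `c'` (of `φ ∘ t`)
  set φ := v.embedding with hφ
  obtain ⟨t, ht⟩ := exists_ringHom_eq_comp φ w.embedding
  obtain ⟨c, hc⟩ := exists_conjugate_eq_comp φ
  obtain ⟨c', hc'⟩ := exists_conjugate_eq_comp w.embedding
  have hv : InfinitePlace.mk φ = v := mk_embedding v
  have hw : w = t⁻¹ • v := by
    rw [← mk_embedding w, ht, ← hv, smul_mk]
    rfl
  refine ⟨t, c, hw, by rw [← hv]; exact smul_mk_eq_of_conjugate_eq_comp hc, ?_⟩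
  -- the squared identity, read in `L`: `t (a · c' a) = X · c X` with `a = s(X) U`
  set a : 𝓞 L := (s • X) * U with ha
  have hsq : (((w (a : L)) ^ 2 : ℝ) : ℂ) = (((v (X : L)) ^ 2 : ℝ) : ℂ) := by rw [h]
  rw [← mk_embedding w, ofReal_apply_sq_eq hc', ← hv, ofReal_apply_sq_eq hc, ht, RingHom.comp_apply] at hsq
  have hL : t ((a : L) * c' (a : L)) = (X : L) * c (X : L) := φ.injective (by simpa using hsq)
  -- as an identity in `𝓞 L`
  have hO : (t • (a * (c' • a)) : 𝓞 L) = X * (c • X) := by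
    apply RingOfIntegers.ext
    have e1 : ((a * c' • a : 𝓞 L) : L) = (a : L) * c' (a : L) := by
      rw [RingOfIntegers.coe_eq_algebraMap, map_mul]; rfl
    have e2 : ((X * c • X : 𝓞 L) : L) = (X : L) * c (X : L) := by
      rw [RingOfIntegers.coe_eq_algebraMap, map_mul]; rfl
    rw [coe_smul_ringOfIntegers, e1, e2]
    exact hL
  -- pass to ideals: `((t s) • 𝔓)ⁿ · ((t c' s) • 𝔓)ⁿ = 𝔓ⁿ · (c • 𝔓)ⁿ`
  have hunit : Ideal.span {(U : 𝓞 L)} = ⊤ := Ideal.span_singleton_eq_top.mpr U.isUnit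
  have hspan_a : Ideal.span {a} = s • 𝔓 ^ n := by
    rw [ha, ← Ideal.span_singleton_mul_span_singleton, hunit, Ideal.mul_top, ← smul_span_singleton, hX]
  have hideal : ((t * s) • 𝔓) ^ n * (((t * c') * s) • 𝔓) ^ n = 𝔓 ^ n * (c • 𝔓) ^ n := by
    have h1 := congrArg (fun Y : 𝓞 L => Ideal.span {Y}) hO
    rw [← smul_span_singleton, ← Ideal.span_singleton_mul_span_singleton, ← smul_span_singleton, hspan_a,
      ← Ideal.span_singleton_mul_span_singleton, ← smul_span_singleton, hX, smul_mul', ← mul_smul,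
      ← mul_smul, ← mul_smul, smul_pow', smul_pow', smul_pow'] at h1
    exact h1
  -- `(t s) • 𝔓` is a prime dividing the right-hand side
  have hprime : ((t * s) • 𝔓).IsMaximal := by
    rw [Ideal.pointwise_smul_def]
    exact Ideal.map_isMaximal_of_equiv (MulSemiringAction.toRingEquiv _ (𝓞 L) (t * s)) (p := 𝔓)
  have hdvd : (t * s) • 𝔓 ∣ 𝔓 ^ n * (c • 𝔓) ^ n := by
    rw [← hideal]
    exact Dvd.dvd.mul_right (dvd_pow_self _ hn) _
  have hP : Prime ((t * s) • 𝔓) :=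
    Ideal.prime_of_isPrime (Ring.ne_bot_of_isMaximal_of_not_isField hprime (RingOfIntegers.not_isField L))
      hprime.isPrime
  rcases hP.dvd_or_dvd hdvd with h1 | h1
  · exact Or.inl (eq_of_dvd_of_isMaximal hprime h𝔓 (hP.dvd_of_dvd_pow h1))
  · refine Or.inr (eq_of_dvd_of_isMaximal hprime ?_ (hP.dvd_of_dvd_pow h1))
    rw [Ideal.pointwise_smul_def]
    exact Ideal.map_isMaximal_of_equiv (MulSemiringAction.toRingEquiv _ (𝓞 L) c) (p := 𝔓)

/-- **Archimedean rigidity**: with `𝔓` of TRIVIAL decomposition group, `w (s(X) · U) = v (X)` forces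
`w = s • v`. [cite: MochizukiFrdI2008, Thm. 6.4 (iv) p.115] -/
theorem eq_smul_of_apply_smul_mul_eq [IsGalois ℚ L] {𝔓 : Ideal (𝓞 L)} (h𝔓 : 𝔓.IsMaximal)
    (htriv : ∀ g : L ≃ₐ[ℚ] L, g • 𝔓 = 𝔓 → g = 1)
    {X : 𝓞 L} {n : ℕ} (hn : n ≠ 0) (hX : Ideal.span {X} = 𝔓 ^ n) (U : (𝓞 L)ˣ) (s : L ≃ₐ[ℚ] L)
    (v w : InfinitePlace L) (h : w ((s • X : 𝓞 L) * U : 𝓞 L) = v (X : L)) : w = s • v := by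
  obtain ⟨t, c, hw, hcv, hor⟩ := smul_eq_or_of_apply_smul_mul_eq h𝔓 hn hX U s v w h
  rcases hor with h1 | h1
  · have hts : t * s = 1 := htriv _ h1
    have hs : s = t⁻¹ := (inv_eq_of_mul_eq_one_right hts).symm
    rw [hw, hs]
  · have hts : c⁻¹ * (t * s) = 1 := htriv _ (by rw [mul_smul, h1, inv_smul_smul])
    have hs : s = t⁻¹ * c := by
      rw [inv_mul_eq_one] at hts
      rw [hts, inv_mul_cancel_left]
    rw [hw, hs, mul_smul, hcv]

end Literature.NumberTheory.NumberFields

end
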